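import Summits.KontsevichZagierPeriods.KontsevichZagierPeriods.Theorems.RootDecompWalshStrataAffineDescent02

/-!
# Root decomposition & Walsh strata — the `d = 3` z-glue for `A ≠ 0` (lens 4, gen 7, part C)

The THREE-DIMENSIONAL GLUE of `QuadricThreeReduction` for quadric normal forms with `A ≠ 0`, modulo the
open companion statement `SqrtDescent₂` of the lens file §21 (spelled out as the hypothesis `hS`):

* `InBaker.of_partition` — `InBaker` is checked piecewise on a finite DISJOINT semialgebraic
  partition of the domain (the non-hereditary companion of `InBaker.of_cover`);
* `Quadric₃` fibre API: the roots `(−B ± √D)/(2A)`, `4A·p = (2Az + B)² − D`, the band description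
  of the cell for `A < 0`, the four clamp regimes `lo > 0 ↔ B > 0 ∧ C₀ < 0`, `lo < 1 ↔ 2A + B < 0 ∨
  C₁ > 0`, `hi > 0 ↔ B > 0 ∨ C₀ > 0`, `hi < 1 ↔ 2A + B < 0 ∧ C₁ < 0` — each DECIDED on an adapted
  atom by its sign vector (this is exactly why the atoms are cut out by `D, C₀, C₁, B, 2A + B`);
* `inBaker_cell3_of_neg` (`A < 0`): `[cell, q]` = band over `(0,1)²` between the clamped roots
  (rule 3) → `[(0,1)², q(κhi − κlo)]` → atoms → per atom `0`, `q` (`affineDescent₂_holds`) or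
  `q·root = affine + (±q/(2A))√D` (`affineDescent₂_holds` + `SqrtDescent₂`);
* `inBaker_cell3_of_pos` (`A > 0`): complement in the cube, `[cube, q]` by two bands, the quadric
  `{p = 0}` is a proper zero set; `SqrtDescent₂` transfers to `K.neg` (atoms permute);
* `inBaker_cell3` (`A ≠ 0`).

References: [KontsevichZagier2001 §1.2 rules (1),(3)], [BCR1998 §2], this node (NODE.md gen 5–7).

This is part 1/3 (§28.1–28.2 and the abstract root regimes: `Fin 3` bookkeeping, `InBaker.of_partition`,
`lo_pos_aux` … `hi_lt_one_aux`); part 2/3 (`RootDecompWalshStrataCellThree02`) = the `Quadric₃` fibre API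
(roots, `pos_iff_of_neg`, clamp regimes decided per atom, `Quadric₃.neg`); part 3/3
(`RootDecompWalshStrataCellThree03`) = the glue `inBaker_cell3_of_neg` / `_of_pos` / `inBaker_cell3`.
-/

noncomputable section

open Literature.NumberTheory.Transcendental
open MeasureTheory Set
open MvPolynomial (aeval X C)
open Literature.ModelTheory.ExponentialFields (IsSemialgebraic isSemialgebraic_univ
  isSemialgebraic_setOf_eval_pos isSemialgebraic_setOf_eval_lt isSemialgebraic_setOf_eval_le
  isSemialgebraic_setOf_eval_nonneg isSemialgebraic_setOf_eval_eq_zero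
  isSemialgebraic_setOf_eval_ne_zero continuous_aeval_real tarski_seidenberg_real_holds)
open Summit.KontsevichZagierPeriods.RootDecompWalshStrata.WalshSpanProof (isSemialgebraic_cubeSet
  isBounded_cubeSet)
open Summit.KontsevichZagierPeriods.RootDecompWalshStrata.ConeSpecimen (unitIoo isSemialgebraic_unitIoo
  unitIoo_subset_Icc mem_unitIoo)
open Summit.KontsevichZagierPeriods.RootDecompWalshStrata.PointlessOctant (boxTwo isSemialgebraic_boxTwo
  boxTwo_subset_Icc)

namespace Summit.KontsevichZagierPeriods.RootDecompWalshStrata.ConicDescent.BallCube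

/-! #### 28.1 `Fin 2` / `Fin 3` bookkeeping -/

/-- `Fin.init z 0 = z 0` on `Fin 3`. [folklore] -/
@[simp] theorem init₃_apply_zero (z : Fin 3 → ℝ) : Fin.init z 0 = z 0 := rfl

/-- `Fin.init z 1 = z 1` on `Fin 3`. [folklore] -/
@[simp] theorem init₃_apply_one (z : Fin 3 → ℝ) : Fin.init z 1 = z 1 := rfl

/-- `Fin.last 2 = 2` in `Fin 3` (PRIVATE: landed twin `Literature…TorusPlanarLift.last_two_eq`, gate lint
`dedup.landed`; later parts keep private copies). [folklore] -/
private theorem last_two₃ : (Fin.last 2 : Fin 3) = 2 := rfl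

/-- `Fin.init v 0 = v 0` on `Fin 2` (PRIVATE: landed twin `…BetaCancellationStubIntegrateOut.intOut_init_zero`). [folklore] -/
@[simp] private theorem init₂_apply_zero (v : Fin 2 → ℝ) : Fin.init v 0 = v 0 := rfl

/-- `Fin.last 1 = 1` in `Fin 2` (PRIVATE: landed twin `…BetaCancellationStubIntegrateOut.intOut_last_one`). [folklore] -/
private theorem last_one₂ : (Fin.last 1 : Fin 2) = 1 := rfl

/-- A predicate holds on `Fin 3` iff it holds on the first two indices and on the last. [folklore] -/
theorem forall_fin_three_iff {P : Fin 3 → Prop} :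
    (∀ j, P j) ↔ (∀ j : Fin 2, P (Fin.castSucc j)) ∧ P 2 :=
  ⟨fun h => ⟨fun j => h (Fin.castSucc j), h _⟩,
    fun h j => Fin.lastCases (motive := P) h.2 (fun i => h.1 i) j⟩

/-- A predicate holds on `Fin 2` iff it holds on the first index and on the last. [folklore] -/
theorem forall_fin_two_iff' {P : Fin 2 → Prop} :
    (∀ j, P j) ↔ (∀ j : Fin 1, P (Fin.castSucc j)) ∧ P 1 :=
  ⟨fun h => ⟨fun j => h (Fin.castSucc j), h _⟩,
    fun h j => Fin.lastCases (motive := P) h.2 (fun i => h.1 i) j⟩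

/-- The open cube `(0,1)³` as a band over the open square. [folklore] -/
theorem cube_iff (z : Fin 3 → ℝ) :
    (∀ j : Fin 3, 0 < z j ∧ z j < 1) ↔ Fin.init z ∈ boxTwo ∧ 0 < z 2 ∧ z 2 < 1 :=
  forall_fin_three_iff

/-- The open square `(0,1)²` as a band over `(0,1)`. [folklore] -/
theorem square_iff (v : Fin 2 → ℝ) :
    (∀ j : Fin 2, 0 < v j ∧ v j < 1) ↔ Fin.init v ∈ unitIoo ∧ 0 < v 1 ∧ v 1 < 1 := by
  rw [mem_unitIoo]
  exact ⟨fun h => ⟨h 0, h 1⟩, fun h j => by fin_cases j <;> [exact h.1; exact h.2]⟩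

/-- Constant `0` is `ℚ`-semialgebraic (PRIVATE: landed twin `…UnfoldedLogStokes.Negative.Kit.sa_zero`). [BCR1998 §2.2] -/
private theorem isSemialgebraicFunOn_zero' {N : ℕ} {X : Set (Fin N → ℝ)} (hX : IsSemialgebraic ℚ X) :
    IsSemialgebraicFunOn ℚ X fun _ => (0 : ℝ) :=
  (isSemialgebraicFunOn_ratCast hX 0).congr fun _ _ => Rat.cast_zero

/-- Constant `1` is `ℚ`-semialgebraic (PRIVATE: landed twin `…UnfoldedLogStokes.Negative.Kit.sa_one`). [BCR1998 §2.2] -/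
private theorem isSemialgebraicFunOn_one' {N : ℕ} {X : Set (Fin N → ℝ)} (hX : IsSemialgebraic ℚ X) :
    IsSemialgebraicFunOn ℚ X fun _ => (1 : ℝ) :=
  (isSemialgebraicFunOn_ratCast hX 1).congr fun _ _ => Rat.cast_one

/-! #### 28.2 `InBaker` on a finite disjoint semialgebraic partition -/

/-- **Partition lemma.** If the domain of `r` is covered by finitely many pairwise disjoint
`ℚ`-semialgebraic sets `A i` and every piece `[domain ∩ A i, f]` lands in the Baker sector, so does
`[domain, f]` (rule (1a) iterated; disjointness makes the statement non-hereditary).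
[KontsevichZagier2001 §1.2 rule (1)] -/
theorem InBaker.of_partition {N : ℕ} {ι : Type*} (s : Finset ι) :
    ∀ (r : KZ.IntegralRep N) (A : ι → Set (Fin N → ℝ)), (∀ i ∈ s, IsSemialgebraic ℚ (A i)) →
      (∀ x ∈ r.domain, ∃ i ∈ s, x ∈ A i) → (∀ i j x, i ≠ j → x ∈ A i → x ∈ A j → False) →
      (∀ i ∈ s, ∀ (T : Set (Fin N → ℝ)) (hT : IsSemialgebraic ℚ T) (hTr : T ⊆ r.domain),
        T = r.domain ∩ A i → InBaker (KZ.of (r.restrict T hT hTr))) →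
      InBaker (KZ.of r) := by
  classical
  induction s using Finset.induction_on with
  | empty =>
    intro r A _ hcov _ _
    refine InBaker.of_domain_eq_empty r (Set.subset_empty_iff.1 fun x hx => ?_)
    obtain ⟨i, hi, _⟩ := hcov x hx
    simp at hi
  | @insert a s ha ih =>
    intro r A hA hcov hdis h
    have hAa : IsSemialgebraic ℚ (A a) := hA a (Finset.mem_insert_self a s)
    have h1s : IsSemialgebraic ℚ (r.domain ∩ A a) := r.isSemialgebraic_domain.inter hAa
    have h2s : IsSemialgebraic ℚ (r.domain \ A a) := r.isSemialgebraic_domain.diff hAa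
    refine InBaker.of_split r h1s h2s inter_subset_left Set.sdiff_subset
      (Set.inter_union_sdiff _ _).symm ?_ ?_ ?_
    · have : r.domain ∩ A a ∩ (r.domain \ A a) = ∅ := by
        ext x
        exact ⟨fun hx => hx.2.2 hx.1.2, fun hx => hx.elim⟩
      rw [this, measure_empty]
    · exact h a (Finset.mem_insert_self a s) _ h1s inter_subset_left rfl
    · refine ih (r.restrict _ h2s Set.sdiff_subset) A (fun i hi => hA i (Finset.mem_insert_of_mem hi))
        ?_ hdis ?_
      · intro x hx
        have hx' : x ∈ r.domain \ A a := hx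
        obtain ⟨i, hi, hxi⟩ := hcov x hx'.1
        rcases Finset.mem_insert.1 hi with rfl | hi
        · exact (hx'.2 hxi).elim
        · exact ⟨i, hi, hxi⟩
      · intro i hi T hT hTr hTeq
        have hia : i ≠ a := fun h => ha (h ▸ hi)
        have hTeq' : T = r.domain ∩ A i := by
          rw [hTeq]
          ext x
          exact ⟨fun hx => ⟨hx.1.1, hx.2⟩,
            fun hx => ⟨⟨hx.1, fun hxa => hdis i a x hia hx.2 hxa⟩, hx.2⟩⟩
        exact h i (Finset.mem_insert_of_mem hi) T hT (fun x hx => (hTr hx).1) hTeq'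

/-! #### 28.3 Quadric fibre API: roots, regimes, atoms -/

section Regimes

/-- `−B + u < 0 ↔ B > 0 ∧ C < 0` for `a < 0`, `u > 0`, `u² = B² − 4aC`. [folklore] -/
theorem lo_pos_aux {a B C u : ℝ} (ha : a < 0) (hu0 : 0 < u) (hu : u ^ 2 = B ^ 2 - 4 * a * C) :
    -B + u < 0 ↔ 0 < B ∧ C < 0 := by
  constructor
  · intro h
    have hB : 0 < B := by linarith
    have h1 : u ^ 2 < B ^ 2 := by
      nlinarith [mul_pos (sub_pos.2 (by linarith : u < B)) (by linarith : 0 < B + u)]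
    refine ⟨hB, ?_⟩
    by_contra hC
    have hC' : 0 ≤ C := not_lt.1 hC
    nlinarith [mul_nonneg (neg_nonneg.2 ha.le) hC']
  · rintro ⟨hB, hC⟩
    have h1 : u ^ 2 < B ^ 2 := by nlinarith [mul_pos_of_neg_of_neg ha hC]
    by_contra h'
    have hle : B ≤ u := by linarith
    nlinarith [mul_nonneg (sub_nonneg.2 hle) (by linarith : 0 ≤ B + u)]

/-- `2a < −B + u ↔ 2a + B < 0 ∨ a + B + C > 0` for `a < 0`, `u > 0`, `u² = B² − 4aC`. [folklore] -/
theorem lo_lt_one_aux {a B C u : ℝ} (ha : a < 0) (hu0 : 0 < u) (hu : u ^ 2 = B ^ 2 - 4 * a * C) :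
    2 * a < -B + u ↔ 2 * a + B < 0 ∨ 0 < a + B + C := by
  constructor
  · intro h
    by_cases he : 2 * a + B < 0
    · exact Or.inl he
    · refine Or.inr ?_
      have he' : 0 ≤ 2 * a + B := not_lt.1 he
      have h1 : (2 * a + B) ^ 2 < u ^ 2 := by
        nlinarith [mul_pos (sub_pos.2 (by linarith : 2 * a + B < u))
          (by linarith : 0 < 2 * a + B + u)]
      by_contra hC
      have hC' : a + B + C ≤ 0 := not_lt.1 hC
      nlinarith [mul_nonneg (neg_nonneg.2 ha.le) (neg_nonneg.2 hC')]
  · rintro (he | hC)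
    · linarith
    · have h1 : (2 * a + B) ^ 2 < u ^ 2 := by nlinarith [mul_pos (neg_pos.2 ha) hC]
      by_contra h'
      have hle : u ≤ 2 * a + B := by linarith
      nlinarith [mul_nonneg (sub_nonneg.2 hle) (by linarith : 0 ≤ 2 * a + B + u)]

/-- `−B − u < 0 ↔ B > 0 ∨ C > 0` for `a < 0`, `u > 0`, `u² = B² − 4aC`. [folklore] -/
theorem hi_pos_aux {a B C u : ℝ} (ha : a < 0) (hu0 : 0 < u) (hu : u ^ 2 = B ^ 2 - 4 * a * C) :
    -B - u < 0 ↔ 0 < B ∨ 0 < C := by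
  constructor
  · intro h
    by_cases hB : 0 < B
    · exact Or.inl hB
    · refine Or.inr ?_
      have hB' : B ≤ 0 := not_lt.1 hB
      have h1 : B ^ 2 < u ^ 2 := by
        nlinarith [mul_pos (sub_pos.2 (by linarith : -B < u)) (by linarith : 0 < u - B)]
      by_contra hC
      have hC' : C ≤ 0 := not_lt.1 hC
      nlinarith [mul_nonneg (neg_nonneg.2 ha.le) (neg_nonneg.2 hC')]
  · rintro (hB | hC)
    · linarith
    · have h1 : B ^ 2 < u ^ 2 := by nlinarith [mul_pos (neg_pos.2 ha) hC]
      by_contra h'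
      have hle : u ≤ -B := by linarith
      nlinarith [mul_nonneg (sub_nonneg.2 hle) (by linarith : 0 ≤ -B + u)]

/-- `2a < −B − u ↔ 2a + B < 0 ∧ a + B + C < 0` for `a < 0`, `u > 0`, `u² = B² − 4aC`. [folklore] -/
theorem hi_lt_one_aux {a B C u : ℝ} (ha : a < 0) (hu0 : 0 < u) (hu : u ^ 2 = B ^ 2 - 4 * a * C) :
    2 * a < -B - u ↔ 2 * a + B < 0 ∧ a + B + C < 0 := by
  constructor
  · intro h
    have he : 2 * a + B < 0 := by linarith
    have h1 : u ^ 2 < (2 * a + B) ^ 2 := by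
      nlinarith [mul_pos (sub_pos.2 (by linarith : u < -(2 * a + B)))
        (by linarith : 0 < -(2 * a + B) + u)]
    refine ⟨he, ?_⟩
    by_contra hC
    have hC' : 0 ≤ a + B + C := not_lt.1 hC
    nlinarith [mul_nonneg (neg_nonneg.2 ha.le) hC']
  · rintro ⟨he, hC⟩
    have h1 : u ^ 2 < (2 * a + B) ^ 2 := by nlinarith [mul_pos_of_neg_of_neg ha hC]
    by_contra h'
    have hle : -(2 * a + B) ≤ u := by linarith
    nlinarith [mul_nonneg (sub_nonneg.2 hle) (by linarith : 0 ≤ -(2 * a + B) + u)]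

end Regimes

end Summit.KontsevichZagierPeriods.RootDecompWalshStrata.ConicDescent.BallCube
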